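import Summits.QuantumFields.YangMills.Theorems.UnitScaleTiltProp7ComplementaryProjectorGradientKernel
import Summits.QuantumFields.YangMills.Theorems.UnitScaleTiltProp7CoarseGramCoercivity
import Summits.QuantumFields.YangMills.Theorems.UnitScaleTiltProp7ComplementaryProjectorBlockDecayKnit
import Summits.QuantumFields.YangMills.Theorems.UnitScaleTiltProp7LODSlotK2WindowLetters
import Summits.QuantumFields.YangMills.Theorems.UnitScaleTiltProp7RieszTauFrobNormT3
import HarnessLib

/-!
# Route `UnitScaleTilt`, crux K1 «MinimiserStabilityRegPr» (stmt-QuantumFields-19200), EX face S45 ✓p763653, row `h349` — **THE (3.49) KERNEL ROW AT THE MEMBER WITH EVERY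
# COMBES–THOMAS LETTER DISCHARGED K-UNIFORMLY, READ BACK IN THE DISPLAY'S CURRENCY** (★p1 g26 CHAIR WORD №1 (B) «namer w2 g12: GO `hK349_exists` + K-free window»; the
# D2-analogue for ★p1 g25's door ✓`Prop7KernelRow349DoorOfLODTarget.kernelRow349_idx_of_projRTarget`, p763458)

Cell `ym3-torus` (HUMAN RULING D-0037, rung R3 — NOT d = 4, NOT infinite volume, NOT a mass gap, NOT Clay).  EX namer seat `ym-ust-19200-w2` (gen 12).  THEOREMS ONLY
(0 `def`, 0 `sorry`); `--supports stmt-QuantumFields-19200 --as helper`, count-neutral.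

WHAT.  ★p1 g25's V6 ✓`Prop7ComplementaryProjectorGradientKernel.norm_equiv_DL2_sub_projR_DstarL2_single_le` (p763095) gives the pointwise kernel of `D_{U₀}(1 − projR Δ_{U₀} Q″)D*_{U₀}`
between two bond spikes from ONE displayed gradient-column letter `hDcol` (the (L3′b)-GRAD storey's output), in the LOD letters (`Q″ hseq ι hι T hT a G hAG hGA`) and with the
Combes–Thomas window∕gap rows `hδ hwin hgap` and the three operator letters `CT CG mB` displayed, conclusion in the `W₂`-currency `‖WL2.equiv … (bondEquiv bd)‖ ≤ (c₀∕c₁)·Cg²·(…)·‖frobEquiv⁻¹Z‖`.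
THIS FILE (one theorem) puts it in the SHAPE OF THE DOOR's `hK349` at ONE member: (i) ★p1 pin (2) `c₁ := c₀·(L³)^{K−n}` so `c₀∕c₁ = ((L:ℝ)^(K−n))⁻¹ ^ 3` (print's `η³`), (ii) `CT CG mB`
DISCHARGED from `RegPr` by ✓`Prop7ComplementaryProjectorBlockDecayKnit.norm_lift_topMean_le` ∕ `norm_massive_inverse_le` ∕ ✓`Prop7CoarseGramCoercivity.coarseGram_coercive` (as routeR-w2's B6
`kernelMatrix_blockBound_of_regPr` did), (iii) the slopes CHOSEN as closed terms of the massive mass `am` and the column rate `κ` — `μ(am) := 1∕(10·√(max 2 (16∕am))·√(27 + (2025∕8)am))`,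
`μ′ := min (μ∕2) (min (m_B(am)∕(3Γ(am))) (κ∕2))` (so `μ′ < μ`, `μ′ < κ`), `δ₁ := √(27 + (2025∕8)am)·μ′` — and `hδ hwin hgap` PROVED for every `η = L^{−(K−n)} ∈ (0,1]` by routeR-w4 g27's
✓`Prop7LODSlotK2WindowLetters.window_delta`∕`window_win`∕`gap_nonneg`∕`gap_le`∕`window_gap` (p760318) — the K-uniformity, (iv) the readback `‖(toL2)⁻¹ f bd‖ = ‖frobEquiv (WL2.equiv f (bondEquiv bd))‖
≤ ‖WL2.equiv f (bondEquiv bd)‖` (✓`Prop7RieszTauFrobNorm.norm_le_norm_frobEquiv_symm`), `‖frobEquiv⁻¹ Z‖ ≤ √2·‖Z‖` (✓`norm_frobEquiv_symm_le`), `tdist` symmetric (✓`tdist_coarse_comm`),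
and the monotone bounds `(m_B²∕2 − 3GAP²)⁻¹ ≤ 6∕m_B²`, `e^{9μ′} ≤ 3`, `1∕(κ − μ′) ≤ 2∕κ`.  OUTPUT ★★★ `kernelRow349_pin`:
`‖(toL2)⁻¹(D_{U₀}((1 − projR Δ_{U₀} Q″)(D*_{U₀}(toL2(δ_b ⊗ Z)))))(bd)‖ ≤ (√2·18∕m_B(am)²·(4(2(1 + 2∕κ))³)²·Cg²)·((L:ℝ)^(K−n))⁻¹ ^ 3·e^{−μ′(am,κ)·tdist(B b.src, B bd.src)}·‖Z‖`
— the body of the door's `hK349` at one member and one `Q″`, CONSTANT AND RATE CLOSED IN `(am, κ, Cg)` (no `K`, `n`, `|T³|`); displayed: `RegPr` (`10⁷L³ε₀ ≤ 1`), the LOD data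
`Q″ hseq ι hι T hT G hAG hGA` at the pinned weight, `0 < am`, `0 < κ`, `0 ≤ Cg`, and `hDcol` (V6's letter VERBATIM) — the (L3′b)-GRAD storey's target.  The Idx-level ∃-packaging
`hK349_exists` (the D4-analogue: `ι` by `rfl`, `T := (ι∘Q″)†`, `G` by ✓`exists_massive_inverse`, `Q″` from the door's ∀-form `htop` by ✓`hseq_of_htop`-class, letters per `L` by `choose`)
follows in a second file once the storey's `hDcol` theorem fixes `Cg(L)`, `κ(L)`.
HONEST SCOPE.  Bookkeeping + real arithmetic over landed rows; CONDITIONAL on `hDcol`; nothing of `h349`, the nine other print rows, `hThm2S`, EX or the crux is proved here.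

References: T. Bałaban, CMP **99** (1985) 389–434 [Balaban1985BackgroundPropagators] ((3.11) p.392, (3.21)–(3.25) p.394, Thm 3.1 (3.42)∕(3.46) pp.397–398, (3.49) p.399, Thm 3.11 p.416);
CMP **116** (1988) 1–22 [Balaban1988RG2Cluster] ((2.7) p.13); CMP **98** (1985) 17–51 [Balaban1985Averaging] ((20) p.21).
-/

set_option autoImplicit false

noncomputable section

open scoped BigOperators Matrix.Norms.L2Operator InnerProductSpace ComplexConjugate Matrix

namespace Summit.QuantumFields.YangMills.Theorems.Prop7KernelRow349Pin

open Literature.MathematicalPhysics.QuantumFieldTheory.Balaban1983to89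
open Literature.MathematicalPhysics.QuantumFieldTheory.Balaban1983to89.T3ContinuumYM3Torus
open T4Continuum BlockAveraging
open BlockAveraging (Idx)
open B7Prop1Explicit (disp)
open B5Eq118OneStroke (iterBlockOf)
open B10Eq27TorusAxialLog (holT transl)
open B7TransferAnalyticMean (meanCLM)
open B9Eq311L2Pairing (WL2)
open B11Eq103H1Complex (SiteL2K BondL2K projR)
open Summit.QuantumFields.YangMills.Theorems.Prop8Chart (emlIterU)
open T3SectALandauChart (eta eta_pos bgUnits)
open T3PrintedRegularMinimiser (RegPr)
open T3PrintedRegularOrbits (sites_eq)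
open T3LevelShift (siteShift)
open Summit.QuantumFields.YangMills.Theorems.Prop7SectET3Transport (periodsT3 bondEquiv)
open Summit.QuantumFields.YangMills.Theorems.Prop7SectET3HilbertLetters (W₂ toL2 toL2S DL2 DstarL2 frobEquiv covLapSite toL2_symm_apply)
open Summit.QuantumFields.YangMills.Theorems.Prop7ComplementaryProjectorGradientKernel (norm_equiv_DL2_sub_projR_DstarL2_single_le)
open Summit.QuantumFields.YangMills.Theorems.Prop7ComplementaryProjectorBlockDecay (norm_lift_topMean_le norm_massive_inverse_le coarseCoercivity_pos)
open Summit.QuantumFields.YangMills.Theorems.Prop7CoarseGramCoercivity (coarseGram_coercive)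
open Summit.QuantumFields.YangMills.Theorems.Prop7BlockDistanceWeights (tdist_coarse_comm)
open Summit.QuantumFields.YangMills.Theorems.Prop7RieszTauFrobNorm (norm_frobEquiv_symm_le norm_le_norm_frobEquiv_symm)
open Summit.QuantumFields.YangMills.Theorems.Prop7LODSlotK2WindowLetters

variable (F : T3Family) {n K : ℕ} (h : n ≤ K) {c₀ : ℝ} [Fact (0 < c₀)]
  {ε₀ : ℝ} (hε₀ : 0 < ε₀) (hε7 : 10 ^ 7 * (F.L : ℝ) ^ 3 * ε₀ ≤ 1)
  (U₀ : GaugeField (F.P K) 0 (Matrix.specialUnitaryGroup (Fin 2) ℂ)) (hreg : RegPr F n K ε₀ U₀)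
  (Q'' : SiteL2K ℂ 3 (periodsT3 F K) c₀ W₂ →ₗ[ℂ] (Site (F.P K) (K - n) → Matrix (Fin 2) (Fin 2) ℂ))
  (hseq : ∀ lam : Site (F.P K) 0 → Matrix (Fin 2) (Fin 2) ℂ, ∃ ns : (j : ℕ) → Site (F.P K) j → Matrix (Fin 2) (Fin 2) ℂ, ns 0 = lam ∧
      (∀ (j : ℕ) (y : Site (F.P K) (j + 1)), ns (j + 1) y = ns j (emb y) - meanCLM (Idx (F.P K)) (Matrix (Fin 2) (Fin 2) ℂ) fun i : Idx (F.P K) =>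
        ns j (emb y) - ((holT (emlIterU j (bgUnits F K U₀)) (emb y) (stairWord i.2.1 (off i.1)) : (Matrix (Fin 2) (Fin 2) ℂ)ˣ) : Matrix (Fin 2) (Fin 2) ℂ) *
          ns j (transl (emb y) (disp (stairWord i.2.1 (off i.1)))) * (((holT (emlIterU j (bgUnits F K U₀)) (emb y) (stairWord i.2.1 (off i.1)))⁻¹ : (Matrix (Fin 2) (Fin 2) ℂ)ˣ) : Matrix (Fin 2) (Fin 2) ℂ)) ∧
      ns (K - n) = Q'' (toL2S F K c₀ lam))

/-- `e^{9μ′} ≤ 3` for `9μ′ ≤ 1`. [folklore] -/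
theorem exp_nine_mul_le_three {μ' : ℝ} (h1 : 9 * μ' ≤ 1) : Real.exp (9 * μ') ≤ 3 := by
  have h2 : Real.exp (9 * μ') ≤ Real.exp 1 := Real.exp_le_exp.2 h1
  have h3 : Real.exp 1 < 3 := lt_trans Real.exp_one_lt_d9 (by norm_num)
  linarith


/-- Monotone bookkeeping of a six-factor product (all factors `≥ 0`). [folklore] -/
theorem prod_le_aux {ℓ3 Cg2 INV E9 BR EX NZ I' B' N' : ℝ} (hℓ : 0 ≤ ℓ3) (hC : 0 ≤ Cg2) (hI0 : 0 ≤ INV) (hI : INV ≤ I') (hE0 : 0 ≤ E9)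
    (hE : E9 ≤ 3) (hB0 : 0 ≤ BR) (hB : BR ≤ B') (hX : 0 ≤ EX) (hN0 : 0 ≤ NZ) (hN : NZ ≤ N') :
    ℓ3 * Cg2 * (INV * E9) * BR * EX * NZ ≤ ℓ3 * Cg2 * (I' * 3) * B' * EX * N' := by
  have hI' : 0 ≤ I' := hI0.trans hI
  have hB' : 0 ≤ B' := hB0.trans hB
  gcongr

include hε₀ hε7 hreg hseq in
set_option maxHeartbeats 400000 in
-- HEARTBEAT rule (README): one V6 instantiation (its closed Gram constant in the statement) + W1's five window rows + monotone bookkeeping; decl-local, as ✓p763095∕✓p760541.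
/-- ★★★ **THE (3.49) KERNEL ROW AT ONE MEMBER, COMBES–THOMAS LETTERS DISCHARGED K-UNIFORMLY, IN THE DOOR's CURRENCY.**  For `n < K`, `U₀ ∈ 𝔘_k(ε₀)` (`10⁷L³ε₀ ≤ 1`), a top nested mean `Q″`
(clause (iv) `hseq`), the LOD massive data at ★p1's pinned coarse weight `c₁ := c₀·(L³)^{K−n}` (`ι hι T hT`, mass `0 < am`, inverse `G hAG hGA`), a column rate `0 < κ` and constant `0 ≤ Cg`
with V6's GRADIENT-COLUMN LETTER `hDcol`: for all bonds `bd b` and `Z`,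
`‖(toL2)⁻¹(D_{U₀}(D*_{U₀}(toL2(δ_b ⊗ Z)) − projR Δ_{U₀} Q″ (D*_{U₀}(toL2(δ_b ⊗ Z)))))(bd)‖ ≤ (√2·(18∕m_B(am)²)·(4(2(1+2∕κ))³)²·Cg²)·((L:ℝ)^(K−n))⁻¹ ^ 3·e^{−μ′(am,κ)·tdist(B b.src, B bd.src)}·‖Z‖`,
`m_B(am) = 2∕((1 + 25∕8)(600(27∕4)⁶ + am))`, `μ′(am,κ) = min (μ(am)∕2) (min (m_B(am)∕(3Γ(am))) (κ∕2))` (closed, see the module docstring) — no `K`, `n`, `|T³|` in constant or rate.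
[cite: Balaban1985BackgroundPropagators, Thm 3.1 (3.42) p.397, (3.49) p.399, Thm 3.11 p.416; Balaban1988RG2Cluster, (2.7) p.13] -/
theorem kernelRow349_pin (hnK : n < K) {am : ℝ} (ham : 0 < am) [hc₁ : Fact (0 < c₀ * ((F.L : ℝ) ^ 3) ^ (K - n))]
    (ι : (Site (F.P K) (K - n) → Matrix (Fin 2) (Fin 2) ℂ) →ₗ[ℂ] SiteL2K ℂ 3 (periodsT3 F n) (c₀ * ((F.L : ℝ) ^ 3) ^ (K - n)) W₂)
    (hι : ∀ c, ι c = toL2S F n (c₀ * ((F.L : ℝ) ^ 3) ^ (K - n)) (fun z => c (siteShift (sites_eq F n K h) z)))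
    (T : SiteL2K ℂ 3 (periodsT3 F n) (c₀ * ((F.L : ℝ) ^ 3) ^ (K - n)) W₂ →ₗ[ℂ] SiteL2K ℂ 3 (periodsT3 F K) c₀ W₂)
    (hT : ∀ (l : SiteL2K ℂ 3 (periodsT3 F K) c₀ W₂) (f : SiteL2K ℂ 3 (periodsT3 F n) (c₀ * ((F.L : ℝ) ^ 3) ^ (K - n)) W₂), ⟪ι (Q'' l), f⟫_ℂ = ⟪l, T f⟫_ℂ)
    (G : SiteL2K ℂ 3 (periodsT3 F K) c₀ W₂ →ₗ[ℂ] SiteL2K ℂ 3 (periodsT3 F K) c₀ W₂)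
    (hAG : ∀ f, covLapSite F n K c₀ U₀ (G f) + (am : ℂ) • T (ι (Q'' (G f))) = f)
    (hGA : ∀ u, G (covLapSite F n K c₀ U₀ u + (am : ℂ) • T (ι (Q'' u))) = u)
    {κ : ℝ} (hκ : 0 < κ) {Cg : ℝ} (hCg : 0 ≤ Cg)
    (hDcol : ∀ (y : Site (F.P K) (K - n)) (Y : Matrix (Fin 2) (Fin 2) ℂ) (b : PBond (F.P K) 0),
      ‖WL2.equiv ℂ _ W₂ (DL2 F n K c₀ U₀ (G (T (ι (Pi.single y Y))))) (bondEquiv F K b)‖ ≤ Cg * Real.exp (-(κ * (Site.tdist (P := F.P K) (iterBlockOf (K - n) b.src) y : ℝ))) * ‖Y‖)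
    (b : PBond (F.P K) 0) (Z : Matrix (Fin 2) (Fin 2) ℂ) (bd : PBond (F.P K) 0) :
    ‖(toL2 F K c₀).symm (DL2 F n K c₀ U₀ (DstarL2 F n K c₀ U₀ (toL2 F K c₀ (Pi.single b Z)) - projR (covLapSite F n K c₀ U₀) Q'' (DstarL2 F n K c₀ U₀ (toL2 F K c₀ (Pi.single b Z))))) bd‖
      ≤ (Real.sqrt 2 * (18 / (2 / ((1 + 25 / 8) * (600 * (27 / 4 : ℝ) ^ 6 + am))) ^ 2) * (4 * (2 * (1 + 2 / κ)) ^ 3) ^ 2 * Cg ^ 2)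
        * ((F.L : ℝ) ^ (K - n))⁻¹ ^ 3
        * Real.exp (-((min ((1 / (10 * Real.sqrt (max 2 (16 / am)) * Real.sqrt (27 + 2025 / 8 * am))) / 2) (min ((2 / ((1 + 25 / 8) * (600 * (27 / 4 : ℝ) ^ 6 + am))) / (3 * (Real.sqrt (max 2 (16 / am)) * (2 + Real.sqrt (max 2 (16 / am))) * (3 * Real.sqrt 3 + 27 + 9 * Real.sqrt am * Real.sqrt (25 / 8) + 81 * am * (25 / 8))
                * (8 * Real.sqrt (max 2 (16 / am)) + 8 * Real.sqrt (max 2 (16 / am)) ^ 2) * (10 * Real.sqrt (25 / 8)) + 9 * (max 2 (16 / am)) * Real.sqrt (25 / 8)))) (κ / 2)))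
            * (Site.tdist (iterBlockOf (K - n) b.src) (iterBlockOf (K - n) bd.src) : ℝ))) * ‖Z‖ := by
  have hc₀ : 0 < c₀ := Fact.out
  have hL1 : (1 : ℝ) < F.L := by exact_mod_cast F.hL.2
  have hL0 : (0 : ℝ) < F.L := by linarith
  -- ★p1's pin `c₁ := c₀(L³)^(K−n)`: the three raw letters are K-free numbers
  have hsx : (25 / 8) * (c₀ * ((F.L : ℝ) ^ 3) ^ (K - n) * ((((F.P K).L : ℝ) ^ (F.P K).d) ^ (K - n))⁻¹ / c₀) = 25 / 8 := by
    rw [show ((F.P K).L : ℝ) = (F.L : ℝ) from rfl, T3Family.P_d]; field_simp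
  have hMraw : 16 * c₀ * ((F.L : ℝ) ^ (K - n)) ^ 3 / (am * (c₀ * ((F.L : ℝ) ^ 3) ^ (K - n))) = 16 / am := by
    rw [← pow_mul, ← pow_mul, Nat.mul_comm]; field_simp
  have hM : max 2 (16 * c₀ * ((F.L : ℝ) ^ (K - n)) ^ 3 / (am * (c₀ * ((F.L : ℝ) ^ 3) ^ (K - n)))) = max 2 (16 / am) := by rw [hMraw]
  have hdEx : 600 * (27 / 4 : ℝ) ^ 6 * (c₀ * ((F.L : ℝ) ^ 3) ^ (K - n) / (c₀ * ((F.L : ℝ) ^ 3) ^ (K - n))) = 600 * (27 / 4 : ℝ) ^ 6 := by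
    rw [div_self (by positivity), mul_one]
  have hratio : c₀ / (c₀ * ((F.L : ℝ) ^ 3) ^ (K - n)) = ((F.L : ℝ) ^ (K - n))⁻¹ ^ 3 := by
    rw [← pow_mul, Nat.mul_comm, pow_mul, inv_pow]; field_simp
  have hη : 0 < eta F n K := eta_pos F n K
  have hη1 : eta F n K ≤ 1 := by
    show ((F.L : ℝ)⁻¹) ^ (K - n) ≤ 1
    exact pow_le_one₀ (inv_nonneg.2 hL0.le) (inv_le_one_of_one_le₀ hL1.le)
  -- the closed letters of the massive mass `am` and the column rate `κ`
  set M' : ℝ := max 2 (16 / am) with hM'def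
  have hM'2 : 2 ≤ M' := le_max_left _ _
  set cδ : ℝ := 27 + 2025 / 8 * am with hcδdef
  have hcδ1 : 1 ≤ cδ := by rw [hcδdef]; linarith [ham.le]
  set μ : ℝ := 1 / (10 * Real.sqrt M' * Real.sqrt cδ) with hμdef
  have hsM1 : 1 ≤ Real.sqrt M' := Real.one_le_sqrt.2 (by linarith)
  have hsc1 : 1 ≤ Real.sqrt cδ := Real.one_le_sqrt.2 hcδ1
  have hμ0 : 0 < μ := by rw [hμdef]; positivity
  have hμ10 : 10 * μ ≤ 1 := by
    rw [hμdef]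
    have h1 : (1 : ℝ) ≤ Real.sqrt M' * Real.sqrt cδ := one_le_mul_of_one_le_of_one_le hsM1 hsc1
    rw [show 10 * (1 / (10 * Real.sqrt M' * Real.sqrt cδ)) = 1 / (Real.sqrt M' * Real.sqrt cδ) by field_simp]
    rw [div_le_one (by positivity)]
    exact h1
  set Γ : ℝ := (Real.sqrt (max 2 (16 / am)) * (2 + Real.sqrt (max 2 (16 / am))) * (3 * Real.sqrt 3 + 27 + 9 * Real.sqrt am * Real.sqrt (25 / 8) + 81 * am * (25 / 8))
          * (8 * Real.sqrt (max 2 (16 / am)) + 8 * Real.sqrt (max 2 (16 / am)) ^ 2) * (10 * Real.sqrt (25 / 8)) + 9 * (max 2 (16 / am)) * Real.sqrt (25 / 8)) with hΓdef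
  have hΓ : 0 < Γ := by rw [hΓdef]; positivity
  set mBc : ℝ := (2 / ((1 + 25 / 8) * (600 * (27 / 4 : ℝ) ^ 6 + am))) with hmBcdef
  have hmBc : 0 < mBc := by rw [hmBcdef]; positivity
  set μ' : ℝ := min (μ / 2) (min (mBc / (3 * Γ)) (κ / 2)) with hμ'def
  have hμ'0 : 0 < μ' := lt_min (by linarith) (lt_min (by positivity) (by linarith))
  have hμ'le : μ' ≤ μ / 2 := min_le_left _ _
  have hμ'lt : μ' < μ := by linarith
  have hμ'3 : 3 * μ' ≤ 1 := by linarith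
  have hμ'9 : 9 * μ' ≤ 1 := by linarith
  have hμ'Γ' : μ' ≤ mBc / (3 * Γ) := (min_le_right _ _).trans (min_le_left _ _)
  have hμ'κ2 : μ' ≤ κ / 2 := (min_le_right _ _).trans (min_le_right _ _)
  have hμ'κ : μ' < κ := by linarith
  -- the window rows at the raw letters (routeR-w4 g27's W1), at slope `μ′`
  have hδ := window_delta (a := am) (sx := ((25 / 8) * (c₀ * ((F.L : ℝ) ^ 3) ^ (K - n) * ((((F.P K).L : ℝ) ^ (F.P K).d) ^ (K - n))⁻¹ / c₀))) (η := eta F n K) ham hsx hη hη1 hμ'0.le hμ'3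
  have hwinμ := window_win ham hM
  have hwin : Real.sqrt (max 2 (16 * c₀ * ((F.L : ℝ) ^ (K - n)) ^ 3 / (am * (c₀ * ((F.L : ℝ) ^ 3) ^ (K - n))))) * (Real.sqrt cδ * μ') ≤ 1 / 10 := by
    refine le_trans ?_ hwinμ
    apply mul_le_mul_of_nonneg_left _ (Real.sqrt_nonneg _)
    exact mul_le_mul_of_nonneg_left hμ'lt.le (Real.sqrt_nonneg _)
  have hG0 := gap_nonneg (a := am) (sx := ((25 / 8) * (c₀ * ((F.L : ℝ) ^ 3) ^ (K - n) * ((((F.P K).L : ℝ) ^ (F.P K).d) ^ (K - n))⁻¹ / c₀))) (η := eta F n K)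
    (M := max 2 (16 * c₀ * ((F.L : ℝ) ^ (K - n)) ^ 3 / (am * (c₀ * ((F.L : ℝ) ^ 3) ^ (K - n))))) (μ' := μ') ham hη (by positivity) hμ'0.le
  have hGle := gap_le (a := am) (sx := ((25 / 8) * (c₀ * ((F.L : ℝ) ^ 3) ^ (K - n) * ((((F.P K).L : ℝ) ^ (F.P K).d) ^ (K - n))⁻¹ / c₀))) (η := eta F n K)
    (M := max 2 (16 * c₀ * ((F.L : ℝ) ^ (K - n)) ^ 3 / (am * (c₀ * ((F.L : ℝ) ^ 3) ^ (K - n))))) (μ' := μ') ham hsx hη hη1 hM hμ'0.le hμ'3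
  have hmBraw : (2 / ((1 + ((25 / 8) * (c₀ * ((F.L : ℝ) ^ 3) ^ (K - n) * ((((F.P K).L : ℝ) ^ (F.P K).d) ^ (K - n))⁻¹ / c₀))) * ((600 * (27 / 4 : ℝ) ^ 6 * (c₀ * ((F.L : ℝ) ^ 3) ^ (K - n) / (c₀ * ((F.L : ℝ) ^ 3) ^ (K - n)))) + am))) = mBc := by
    rw [hsx, hdEx]
  have hμ'Γ : μ' ≤ (2 / ((1 + ((25 / 8) * (c₀ * ((F.L : ℝ) ^ 3) ^ (K - n) * ((((F.P K).L : ℝ) ^ (F.P K).d) ^ (K - n))⁻¹ / c₀))) * ((600 * (27 / 4 : ℝ) ^ 6 * (c₀ * ((F.L : ℝ) ^ 3) ^ (K - n) / (c₀ * ((F.L : ℝ) ^ 3) ^ (K - n)))) + am))) / (3 * Γ) := by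
    rw [hmBraw]; exact hμ'Γ'
  obtain ⟨hgap, hP2pos, hP2⟩ := window_gap hG0 hGle hΓ (by rw [hmBraw]; exact hmBc) hμ'Γ
  -- the three operator letters at `RegPr` (routeR-w2's B6 dischargers)
  have hCTb := norm_lift_topMean_le F h hε₀ hε7 U₀ hreg Q'' hseq ι hι
  have hGn := norm_massive_inverse_le F h hε₀ hε7 U₀ hreg Q'' hseq ι hι T hT ham G hAG
  have hcoer := coarseGram_coercive F hnK h hε₀ hε7 U₀ hreg Q'' hseq ι hι T hT ham G hAG
  have hmB := coarseCoercivity_pos F (n := n) (K := K) (c₀ := c₀) (c₁ := c₀ * ((F.L : ℝ) ^ 3) ^ (K - n)) ham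
  -- V6 at these letters
  have hV6 := norm_equiv_DL2_sub_projR_DstarL2_single_le F h hε₀ hε7 U₀ hreg Q'' hseq ι hι T hT ham G hAG hGA hμ'0.le hμ'κ
    (δ₁ := Real.sqrt cδ * μ') (by positivity) hδ hwin (Real.sqrt_nonneg _) hCTb (by positivity) hGn hmB hcoer hgap hCg hDcol bd b Z
  -- readback and monotone bookkeeping
  have hLHS : ‖(toL2 F K c₀).symm (DL2 F n K c₀ U₀ (DstarL2 F n K c₀ U₀ (toL2 F K c₀ (Pi.single b Z)) - projR (covLapSite F n K c₀ U₀) Q'' (DstarL2 F n K c₀ U₀ (toL2 F K c₀ (Pi.single b Z))))) bd‖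
      ≤ ‖WL2.equiv ℂ _ W₂ (DL2 F n K c₀ U₀ (DstarL2 F n K c₀ U₀ (toL2 F K c₀ (Pi.single b Z)) - projR (covLapSite F n K c₀ U₀) Q'' (DstarL2 F n K c₀ U₀ (toL2 F K c₀ (Pi.single b Z))))) (bondEquiv F K bd)‖ := by
    rw [toL2_symm_apply]
    have := norm_le_norm_frobEquiv_symm (frobEquiv (WL2.equiv ℂ _ W₂ (DL2 F n K c₀ U₀ (DstarL2 F n K c₀ U₀ (toL2 F K c₀ (Pi.single b Z)) - projR (covLapSite F n K c₀ U₀) Q'' (DstarL2 F n K c₀ U₀ (toL2 F K c₀ (Pi.single b Z))))) (bondEquiv F K bd)))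
    rwa [LinearEquiv.symm_apply_apply] at this
  have hZ : ‖(frobEquiv.symm Z : W₂)‖ ≤ Real.sqrt 2 * ‖Z‖ := norm_frobEquiv_symm_le Z
  have hexp9 : Real.exp (9 * μ') ≤ 3 := exp_nine_mul_le_three hμ'9
  have hκμ : 1 / (κ - μ') ≤ 2 / κ := by
    rw [div_le_div_iff₀ (by linarith only [hμ'κ]) hκ]; linarith only [hμ'κ2]
  have hbr : (4 * (2 * (1 + 1 / (κ - μ'))) ^ 3) ^ 2 ≤ (4 * (2 * (1 + 2 / κ)) ^ 3) ^ 2 := by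
    have h0 : 0 ≤ 1 / (κ - μ') := div_nonneg zero_le_one (by linarith only [hμ'κ])
    gcongr
  have htd : (Site.tdist (iterBlockOf (K - n) bd.src) (iterBlockOf (K - n) b.src) : ℝ) = (Site.tdist (iterBlockOf (K - n) b.src) (iterBlockOf (K - n) bd.src) : ℝ) :=
    tdist_coarse_comm F _ _
  rw [htd, hratio] at hV6
  have hI0 := (inv_pos.2 hP2pos).le
  refine hLHS.trans (hV6.trans ((prod_le_aux (by positivity) (sq_nonneg Cg) hI0 hP2 (Real.exp_pos _).le hexp9 (by positivity) hbr
    (Real.exp_pos _).le (norm_nonneg _) hZ).trans (le_of_eq ?_)))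
  rw [hmBraw, hmBcdef]
  ring

end Summit.QuantumFields.YangMills.Theorems.Prop7KernelRow349Pin

end
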